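import Summits.ABC.IUTFork.Cor312ShellLatticeReal
import Summits.ABC.IUTFork.Cor312VolumesPadicLatticeBounds
import Summits.ABC.IUTFork.Cor312SettingDHVol
import Mathlib.Algebra.BigOperators.Pi
import HarnessLib

/-!
# [IUTchIII] Corollary 3.12, statement — the image of the integral structure IS the product of the tensor
# log-shell lattices; at a good prime it is the unit polydisc `Π 𝒪_L` (a hull-set)

Record-only file (D-0012) of the abc-iut cell (Cor. 3.12 sub-crew, seat abc-iut-c312-7, gen 2; TEAM A row A-0 leftover
«ThetaFinite»); TAKES NO SIDE. Companion of `Cor312ShellLatticeReal`. For a `p`-adic presentation `P` of the log-shell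
carriers over `v_ℚ = p` (seat c312-5 `Cor312Vol.PadicPresentation`: `log(𝒟^⊢_v) ≅ K_v`, `ℐ_v = c·log_p(𝒪^×_{K_v})`,
[IUTchIII] Def. 1.1 (i); Dupuy–Hilado §4) the comparison `e : 𝓘^ℚ(^{S^±_{j+1}};𝒟^⊢_{v_ℚ}) → Π_{v⃗} X_{v⃗}` ([IUTchIII] Prop.
3.1 (i); S. Mochizuki, *Inter-universal Teichmüller theory III*, kurims `paper:url-4b091feeb646`, p. 92) carries the
integral structure `I(^{S^±_{j+1}};𝒟^⊢_{v_ℚ}) = LogShells.shellPk` of Prop. 3.2 (ii) (p. 98, "by forming suitable direct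
sums and tensor products") ONTO the direct product of the tensor log-shell lattices:

* `comparison_image_shellPk_eq` — `e(I(^{S^±_{j+1}};𝒟^⊢_{v_ℚ})) = Π_{v⃗} c^{j+1}·log_p(R^×_{v⃗})` (campaign-S `logPacket`,
  [IUTchIV] Prop. 1.2 p. 10; Dupuy–Hilado §4.7 `I_{v⃗} = (2p)^{−(j+1)}·⊗ log(𝒪^×)`): `⊆` is
  `comparison_mem_smul_logPacket`; `⊇` because the element concentrated at `v⃗` with value `c^{j+1}·⊗_a y_a` is `e`
  of the shell tensor `⊗_a δ_{v⃗ a}(φ⁻¹(c·y_a))` (campaign-S `piTensorDistrib_tprod_single` shape);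
* DICTIONARY with seat c312-5 (gen 3)'s lattice route (`Cor312VolumesPadicLattice` p416953 /
  `Cor312VolumesPadicLatticeBounds` p417666, cited BY NAME, not re-derived): `e(I(−)) = summandLattice j ((c·2p)^{j+1})`
  (`comparison_image_shellPk_eq_summandLattice`; abc-iut-c312-3's `logShell = (2p)^{−(j+1)}·logPacket`), hence the
  saturated lattice of `Cor312ShellLatticeReal` is `W_p = e⁻¹(e(I(−))) = latticePk j ((c·2p)^{j+1}) ⊇ I(−)`
  (`preimage_image_shellPk_eq_latticePk`, `shellPk_subset_latticePk`), and in field-factor coordinates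
  (`factorCoords`, = the factor-side comparison of `Cor312ShellLatticeReal` by `rfl`: `sigmaFactor_eq_factorCoords_comp` —
  the MERGE-MAP bridge O2 of the w5-d204 audit of p417850; c312-5's `PadicPresentation.factorMap` of `Cor312SettingDHVol` is
  the same function by `rfl`, not imported here) `Λ_p = latticeF j ((c·2p)^{j+1})`;
* `smul_logPacket_eq_normalizedPacket` — at a GOOD prime (`p > 2`, every factor absolutely unramified, `|I| ≥ 2`) and
  for ANY scalar `c` with `‖c·p‖ = 1` (e.g. `c = (p^*)⁻¹ = p⁻¹` of [IUTchIII] Def. 1.1 (i) for odd `p`):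
  `c^{|I|}·log_p(R_I^×) = (R_I)^∼` (campaign-S `coe_logPacket_eq_smul_integerPacket`, `smul_coe_integerPacket_of_norm_eq_one`,
  `integerPacket_eq_normalizedPacket_of_unramified`; [IUTchIV] Prop. 1.1, 1.2 (i)) — the norm-one-scalar companion of
  c312-5's `summandLattice_one_eq_of_unramified` (scalar `1`);
* `factorCoords_image_shellPk_eq_hullSet` / `isHullSet_factorCoords_image_shellPk` — hence at such a prime the
  factor-side image `Λ_p` of the integral structure IS the unit polydisc `Π_{(v⃗,i)} 𝒪_{L_{v⃗,i}} = hullSet 1`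
  (campaign-S `image_normalizedPacket_eq_coe`; c312-5's `latticeF_one_eq_hullSet_of_unramified` is the `latticeF 1`
  form), in particular a hull-set `λ·𝒪_L`.
Bookkeeping over landed campaign-S / c312-5 / c312-3 theorems. [claim: Mochizuki2012, status: disputed] for the quoted
objects; [cite: Mochizuki2012, IUTchIV Prop. 1.1 p. 9, Prop. 1.2 (i) p. 10, Prop. 1.4 (i) p. 13]; [cite: DupuyHilado2025,
§4 (intro), §4.7]. Deliberately NOT here: ramified primes, `p = 2`, the Θ-boxes and the real Dupuy–Hilado setting
(c312-5 gen 3 `Cor312HullDefinedDHVol` / `Cor312ThetaFiniteDHVol`, c312-3 gen 4 `Cor312ThetaBoxesDH`), any judgement.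
-/

noncomputable section

open Set Function
open scoped Pointwise

namespace Summit.ABC.IUTFork.Cor312Vol

open Thm311 Literature.IUT.LogThetaLattice Literature.IUT.LogVolume Literature.LinearAlgebra.BaseChange

variable {T : ThetaIndex}

namespace PadicPresentation

variable {L : LogShells T} {vQ : T.VQ} {p : ℕ} [Fact p.Prime] (P : PadicPresentation L vQ p)

/-! ## 1. `e(I(^{S^±_{j+1}};𝒟^⊢_{v_ℚ})) = Π_{v⃗} c^{j+1}·log_p(R^×_{v⃗})` -/

/-- `φ_v⁻¹(c·y) ∈ ℐ_v` for `y ∈ log_p(𝒪^×_{K_v})` (`shell_eq`). [claim: Mochizuki2012, status: disputed] -/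
theorem symm_smul_mem_shell (v : T.Fibre vQ) {y : P.k v} (hy : y ∈ logUnits (P.k v)) :
    (P.φ v).symm (P.c • y) ∈ L.shell v.1 := by
  have h : P.c • y ∈ P.φ v '' L.shell v.1 := by
    rw [P.shell_eq v]
    exact Set.smul_mem_smul_set hy
  obtain ⟨s, hs, hsy⟩ := h
  rw [← hsy, LinearEquiv.symm_apply_apply]
  exact hs

open scoped Classical in
/-- **The element concentrated at `v⃗` with value `c^{j+1}·⊗_a y_a` (`y_a ∈ log_p(𝒪^×)`) is `e` of a shell tensor**,
namely of `⊗_a δ_{v⃗ a}(φ⁻¹(c·y_a))` ([IUTchIII] Prop. 3.1 (i) "`⊗_α (⊕_v …) = ⊕_{v⃗} ⊗_α …`"; campaign-S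
`piTensorDistrib_tprod_single`). [claim: Mochizuki2012, status: disputed] -/
theorem single_smul_purePacket_mem_image_shellPk (j : T.Label) (e : T.Caps j → T.Fibre vQ)
    (y : ∀ a, P.kk e a) (hy : ∀ a, y a ∈ logUnits (P.kk e a)) :
    (Pi.single e ((P.c ^ ((j : ℕ) + 1)) • purePacket p (P.kk e) y) : ∀ e' : T.Caps j → T.Fibre vQ, P.X e') ∈
      P.comparison j '' (L.shellPk j vQ : Set (L.Packet j vQ)) := by
  set x : T.Caps j → L.Packet1 vQ := fun a => Pi.single (e a) ((P.φ (e a)).symm (P.c • y a)) with hx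
  refine ⟨L.tprod j vQ x, AddSubgroup.subset_closure ⟨x, fun a v => ?_, rfl⟩, ?_⟩
  · by_cases hv : v = e a
    · subst hv
      simp only [hx, Pi.single_eq_same]
      exact L.shell_subset_shellSubgroup _ (P.symm_smul_mem_shell (e a) (hy a))
    · simp only [hx, Pi.single_eq_of_ne hv]
      exact (L.shellSubgroup v.1).zero_mem
  · funext e'
    rw [show L.tprod j vQ x = PiTensorProduct.tprod ℚ x from rfl, P.comparison_tprod]
    by_cases he : e' = e
    · subst he
      rw [Pi.single_eq_same]
      have h1 : (fun a => P.φ (e' a) (x a (e' a))) = fun a => (fun _ : T.Caps j => P.c) a • y a := by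
        funext a
        simp only [hx, Pi.single_eq_same, LinearEquiv.apply_symm_apply]
      rw [h1]
      show purePacket p (P.kk e') (fun a => (fun _ : T.Caps j => P.c) a • y a) = _
      rw [purePacket_smul]
      simp only [Finset.prod_const, Finset.card_univ, Fintype.card_fin]
    · rw [Pi.single_eq_of_ne he]
      obtain ⟨a, ha⟩ := Function.ne_iff.mp he
      refine (PiTensorProduct.tprod ℚ_[p]).map_coord_zero a ?_
      show P.φ (e' a) (x a (e' a)) = 0
      simp only [hx, Pi.single_eq_of_ne ha, map_zero]

/-- **`e(I(^{S^±_{j+1}};𝒟^⊢_{v_ℚ})) = Π_{v⃗} c^{j+1}·log_p(R^×_{v⃗})`**: the comparison carries the integral structure of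
[IUTchIII] Prop. 3.2 (ii) ONTO the direct product over the summands `v⃗` of the scaled tensor log-shell lattices
(Dupuy–Hilado §4.7 `I_{v⃗}`). [claim: Mochizuki2012, status: disputed] -/
theorem comparison_image_shellPk_eq (j : T.Label) :
    P.comparison j '' (L.shellPk j vQ : Set (L.Packet j vQ)) =
      Set.pi Set.univ fun e : T.Caps j → T.Fibre vQ =>
        (P.c ^ ((j : ℕ) + 1)) • (logPacket p (P.kk e) : Set (P.X e)) := by
  classical
  haveI : Fintype (T.Fibre vQ) := Fintype.ofFinite _
  refine Set.Subset.antisymm ?_ ?_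
  · rintro _ ⟨x, hx, rfl⟩
    exact Set.mem_univ_pi.mpr fun e => P.comparison_mem_smul_logPacket j hx e
  · intro z hz
    -- `e(shellPk)` as an additive subgroup
    let K : AddSubgroup (∀ e : T.Caps j → T.Fibre vQ, P.X e) :=
      (L.shellPk j vQ).map (P.comparison j).toAddMonoidHom
    have hK : (K : Set (∀ e : T.Caps j → T.Fibre vQ, P.X e)) = P.comparison j '' (L.shellPk j vQ : Set _) :=
      AddSubgroup.coe_map _ _
    have hsingle : ∀ (e : T.Caps j → T.Fibre vQ) (w : P.X e), w ∈ logPacket p (P.kk e) →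
        (Pi.single e ((P.c ^ ((j : ℕ) + 1)) • w) : ∀ e' : T.Caps j → T.Fibre vQ, P.X e') ∈ K := by
      intro e w hw
      induction hw using AddSubgroup.closure_induction with
      | mem t ht =>
        obtain ⟨y, hy, rfl⟩ := ht
        have h := P.single_smul_purePacket_mem_image_shellPk j e y hy
        rwa [← hK] at h
      | zero =>
        rw [smul_zero, Pi.single_zero]
        exact K.zero_mem
      | add a b _ _ ha hb =>
        rw [smul_add, Pi.single_add]
        exact K.add_mem ha hb
      | neg a _ ha =>
        rw [smul_neg, Pi.single_neg]
        exact K.neg_mem ha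
    rw [← hK, ← Finset.univ_sum_single z]
    refine K.sum_mem fun e _ => ?_
    obtain ⟨w, hw, hwz⟩ := Set.mem_smul_set.mp (Set.mem_univ_pi.mp hz e)
    rw [← hwz]
    exact hsingle e w hw

/-- … so the factor-side image `Λ_p` is the corresponding direct product read through the `ψ_{v⃗}`:
`y ∈ Λ_p ↔ ∀ v⃗, ψ_{v⃗}⁻¹(y_{v⃗,·}) ∈ c^{j+1}·log_p(R^×_{v⃗})`. [folklore] -/
theorem mem_sigmaFactor_image_shellPk_iff (j : T.Label)
    (y : ∀ s : (Σ e : T.Caps j → T.Fibre vQ, DIdx p (P.kk e)), DFac p (P.kk s.1) s.2) :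
    y ∈ (fun (x : L.Packet j vQ) (s : Σ e : T.Caps j → T.Fibre vQ, DIdx p (P.kk e)) =>
        dEquiv p (P.kk s.1) (P.comparison j x s.1) s.2) '' (L.shellPk j vQ : Set (L.Packet j vQ)) ↔
      ∀ e : T.Caps j → T.Fibre vQ, (dEquiv p (P.kk e)).symm (fun i => y ⟨e, i⟩) ∈
        (P.c ^ ((j : ℕ) + 1)) • (logPacket p (P.kk e) : Set (P.X e)) := by
  constructor
  · rintro ⟨x, hx, rfl⟩ e
    have h : (dEquiv p (P.kk e)).symm (fun i => dEquiv p (P.kk e) (P.comparison j x e) i) = P.comparison j x e :=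
      (dEquiv p (P.kk e)).symm_apply_apply _
    rw [h]
    exact P.comparison_mem_smul_logPacket j hx e
  · intro hy
    have hz : (fun e => (dEquiv p (P.kk e)).symm fun i => y ⟨e, i⟩) ∈
        P.comparison j '' (L.shellPk j vQ : Set (L.Packet j vQ)) := by
      rw [P.comparison_image_shellPk_eq j]
      exact Set.mem_univ_pi.mpr hy
    obtain ⟨x, hx, hxz⟩ := hz
    refine ⟨x, hx, funext fun s => ?_⟩
    have h := congrFun hxz s.1
    show dEquiv p (P.kk s.1) (P.comparison j x s.1) s.2 = y s
    rw [h, AlgEquiv.apply_symm_apply]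

/-! ## 1b. Dictionary with seat c312-5's lattice route (`summandLattice` / `latticePk` / `factorCoords` / `latticeF`) -/

/-- The factor-side comparison of `Cor312ShellLatticeReal` IS `factorCoords ∘ e` (c312-5 gen 3
`PadicPresentation.factorCoords`, `Cor312VolumesPadicLatticeBounds`). [folklore] -/
theorem sigmaFactor_eq_factorCoords_comp (j : T.Label) :
    (fun (x : L.Packet j vQ) (s : Σ e : T.Caps j → T.Fibre vQ, DIdx p (P.kk e)) =>
        dEquiv p (P.kk s.1) (P.comparison j x s.1) s.2) = fun x => P.factorCoords j (P.comparison j x) :=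
  rfl

/-- **`e(I(^{S^±_{j+1}};𝒟^⊢_{v_ℚ})) = summandLattice j ((c·2p)^{j+1})`**: the image of the integral structure is c312-5's
scaled log-shell lattice `Π_{v⃗} (c·2p)^{j+1}·I_{v⃗}` (abc-iut-c312-3 `logShell = (2p)^{−(j+1)}·log_p(R^×)`, so
`(c·2p)^{j+1}·I_{v⃗} = c^{j+1}·log_p(R^×_{v⃗})`). [cite: DupuyHilado2025, §4 (intro)] -/
theorem comparison_image_shellPk_eq_summandLattice (j : T.Label) :
    P.comparison j '' (L.shellPk j vQ : Set (L.Packet j vQ)) =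
      P.summandLattice j ((P.c * (2 * p)) ^ ((j : ℕ) + 1)) := by
  rw [P.comparison_image_shellPk_eq j, summandLattice]
  refine congrArg (Set.pi Set.univ) (funext fun e => ?_)
  have h2p : ((2 * p : ℚ_[p]) ^ Fintype.card (T.Caps j)) ≠ 0 :=
    pow_ne_zero _ (mul_ne_zero two_ne_zero (Nat.cast_ne_zero.mpr (Fact.out : p.Prime).ne_zero))
  rw [logShell, shellScalar, smul_smul, Fintype.card_fin, mul_pow, mul_assoc, mul_inv_cancel₀, mul_one]
  rwa [Fintype.card_fin] at h2p

/-- … so the saturated stable lattice of `Cor312ShellLatticeReal` is c312-5's `latticePk j ((c·2p)^{j+1})`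
(`= e⁻¹(Π_{v⃗} (c·2p)^{j+1}·I_{v⃗})`, (Ind1)/(Ind2)-stable by c312-5's `family_image_latticePk` as well as by
`PadicPresentation.image_preimage_image_shellPk`). [folklore] -/
theorem preimage_image_shellPk_eq_latticePk (j : T.Label) :
    P.comparison j ⁻¹' (P.comparison j '' (L.shellPk j vQ : Set (L.Packet j vQ))) =
      P.latticePk j ((P.c * (2 * p)) ^ ((j : ℕ) + 1)) := by
  rw [P.comparison_image_shellPk_eq_summandLattice j, latticePk]

/-- The integral structure lies in that lattice preimage: `I(^{S^±_{j+1}};𝒟^⊢_{v_ℚ}) ⊆ latticePk j ((c·2p)^{j+1})`.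
[folklore] -/
theorem shellPk_subset_latticePk (j : T.Label) :
    (L.shellPk j vQ : Set (L.Packet j vQ)) ⊆ P.latticePk j ((P.c * (2 * p)) ^ ((j : ℕ) + 1)) := by
  rw [← P.preimage_image_shellPk_eq_latticePk j]
  exact Set.subset_preimage_image _ _

/-- In field-factor coordinates: `Λ_p := factorCoords(e(I(−))) = latticeF j ((c·2p)^{j+1})` (c312-5's `latticeF`).
[folklore] -/
theorem factorCoords_image_shellPk_eq_latticeF (j : T.Label) :
    (fun x => P.factorCoords j (P.comparison j x)) '' (L.shellPk j vQ : Set (L.Packet j vQ)) =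
      P.latticeF j ((P.c * (2 * p)) ^ ((j : ℕ) + 1)) := by
  rw [show (fun x => P.factorCoords j (P.comparison j x)) = P.factorCoords j ∘ P.comparison j from rfl,
    Set.image_comp, P.comparison_image_shellPk_eq_summandLattice j, latticeF]

/-! ## 2. At a good prime: `c^{j+1}·log_p(R^×_{v⃗}) = (R_{v⃗})^∼` and `Λ_p = Π 𝒪_L` -/

/-- **`c^{|I|}·log_p(R_I^×) = (R_I)^∼` at a good prime**: for `p > 2`, all factors absolutely unramified, `|I| ≥ 2`
and `‖c·p‖ = 1` (e.g. `c = (p^*)⁻¹ = p⁻¹`): `log_p(R_I^×) = p^{|I|}·R_I` ([IUTchIV] Prop. 1.2 (i), campaign-S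
`coe_logPacket_eq_smul_integerPacket`), `(cp)^{|I|}·R_I = R_I` (norm-one scalar), `R_I = (R_I)^∼` ([IUTchIV] Prop.
1.1, `integerPacket_eq_normalizedPacket_of_unramified`). [cite: Mochizuki2012, IUTchIV Prop. 1.2 (i) p. 10] -/
theorem smul_logPacket_eq_normalizedPacket {I : Type} [Fintype I] [DecidableEq I] (k : I → Type)
    [∀ i, NontriviallyNormedField (k i)] [∀ i, NormedAlgebra ℚ_[p] (k i)] [∀ i, IsUltrametricDist (k i)]
    [∀ i, ProperSpace (k i)] (hI : 2 ≤ Fintype.card I) (hp : 2 < p) (he : ∀ i, absRamificationIdx p (k i) = 1)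
    {c : ℚ_[p]} (hc : ‖c * p‖ = 1) :
    (c ^ Fintype.card I) • (logPacket p k : Set (PacketAlgebra p k)) = (normalizedPacket p k : Set (PacketAlgebra p k)) := by
  haveI : Nonempty I := Fintype.card_pos_iff.mp (by omega)
  rw [coe_logPacket_eq_smul_integerPacket p k hp he, smul_smul, ← mul_pow,
    ← integerPacket_eq_normalizedPacket_of_unramified p k hI he]
  exact smul_coe_integerPacket_of_norm_eq_one p k (by rw [norm_pow, hc, one_pow])

/-- **At a good prime the factor-side image of the integral structure is the UNIT POLYDISC `Π_{(v⃗,i)} 𝒪_{L_{v⃗,i}}`**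
(`= 1·𝒪_L`, campaign-S `hullSet … 1`): `p > 2`, every `K_v` (`v | v_ℚ`) absolutely unramified, `‖c·p‖ = 1`, label
`j ≥ 1` (so `|S^±_{j+1}| ≥ 2`). ([IUTchIV] Prop. 1.4 (i): `ψ((R_I)^∼) = Π 𝒪_{L_j}`, campaign-S
`image_normalizedPacket_eq_coe`.) [cite: Mochizuki2012, IUTchIV Prop. 1.4 (i) p. 13] -/
theorem factorCoords_image_shellPk_eq_hullSet (j : T.Label) (hj : 1 ≤ (j : ℕ)) (hp : 2 < p)
    (he : ∀ v : T.Fibre vQ, absRamificationIdx p (P.k v) = 1) (hc : ‖P.c * p‖ = 1) :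
    (fun x => P.factorCoords j (P.comparison j x)) '' (L.shellPk j vQ : Set (L.Packet j vQ)) =
      hullSet (fun s : (Σ e : T.Caps j → T.Fibre vQ, DIdx p (P.kk e)) => DFac p (P.kk s.1) s.2) 1 := by
  classical
  rw [← P.sigmaFactor_eq_factorCoords_comp j]
  have hI : ∀ e : T.Caps j → T.Fibre vQ, 2 ≤ Fintype.card (T.Caps j) := fun _ => by
    rw [Fintype.card_fin]; omega
  have hnorm : ∀ e : T.Caps j → T.Fibre vQ,
      (P.c ^ ((j : ℕ) + 1)) • (logPacket p (P.kk e) : Set (P.X e)) = (normalizedPacket p (P.kk e) : Set (P.X e)) :=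
    fun e => by
      have h := smul_logPacket_eq_normalizedPacket (p := p) (P.kk e) (hI e) hp (fun a => he (e a)) hc
      rwa [Fintype.card_fin] at h
  -- membership in `(R_{v⃗})^∼` read through `ψ_{v⃗}`: all coordinates of norm `≤ 1`
  have hball : ∀ (e : T.Caps j → T.Fibre vQ) (z : P.X e),
      z ∈ (normalizedPacket p (P.kk e) : Set (P.X e)) ↔ ∀ i, ‖dEquiv p (P.kk e) z i‖ ≤ 1 := by
    intro e z
    have himg : dEquiv p (P.kk e) z ∈ dEquiv p (P.kk e) '' (normalizedPacket p (P.kk e) : Set (P.X e)) ↔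
        z ∈ (normalizedPacket p (P.kk e) : Set (P.X e)) :=
      (dEquiv p (P.kk e)).injective.mem_set_image
    rw [← himg, image_normalizedPacket_eq_coe, coe_piUnitBallStructure, mem_polydisc]
  ext y
  rw [P.mem_sigmaFactor_image_shellPk_iff j y]
  simp only [hullSet, mem_polydisc, Pi.one_apply, norm_one]
  constructor
  · intro hy s
    have h := (hball s.1 _).mp (by rw [← hnorm s.1]; exact hy s.1) s.2
    rwa [AlgEquiv.apply_symm_apply] at h
  · intro hy e
    rw [hnorm e]
    exact (hball e _).mpr fun i => by rw [AlgEquiv.apply_symm_apply]; exact hy ⟨e, i⟩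

/-- … in particular `Λ_p` is a HULL-SET `λ·𝒪_L` (with `λ = 1`) at such a prime (the good-place shape consumed by
`Cor312ThetaFiniteReal.hullDefined_and_thetaHull_eq_of_isHullSet`; c312-5's `latticeF_one_eq_hullSet_of_unramified`
is the scalar-`1` form). [folklore] -/
theorem isHullSet_factorCoords_image_shellPk (j : T.Label) (hj : 1 ≤ (j : ℕ)) (hp : 2 < p)
    (he : ∀ v : T.Fibre vQ, absRamificationIdx p (P.k v) = 1) (hc : ‖P.c * p‖ = 1) :
    IsHullSet (fun s : (Σ e : T.Caps j → T.Fibre vQ, DIdx p (P.kk e)) => DFac p (P.kk s.1) s.2)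
      ((fun x => P.factorCoords j (P.comparison j x)) '' (L.shellPk j vQ : Set (L.Packet j vQ))) :=
  ⟨1, fun _ => one_ne_zero, P.factorCoords_image_shellPk_eq_hullSet j hj hp he hc⟩

/-- The same lattice in c312-5's vocabulary: `latticeF j ((c·2p)^{j+1})` is the unit polydisc at such a prime.
[cite: Mochizuki2012, IUTchIV Prop. 1.4 (i) p. 13] -/
theorem latticeF_smul_eq_hullSet_of_unramified (j : T.Label) (hj : 1 ≤ (j : ℕ)) (hp : 2 < p)
    (he : ∀ v : T.Fibre vQ, absRamificationIdx p (P.k v) = 1) (hc : ‖P.c * p‖ = 1) :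
    P.latticeF j ((P.c * (2 * p)) ^ ((j : ℕ) + 1)) =
      hullSet (fun s : (Σ e : T.Caps j → T.Fibre vQ, DIdx p (P.kk e)) => DFac p (P.kk s.1) s.2) 1 := by
  rw [← P.factorCoords_image_shellPk_eq_latticeF j]
  exact P.factorCoords_image_shellPk_eq_hullSet j hj hp he hc

end PadicPresentation

end Summit.ABC.IUTFork.Cor312Vol

end

/-! ## Appendix (MERGE-MAP O2, completed): c312-5's `PadicPresentation.factorMap` IS `factorCoords ∘ e` -/

namespace Summit.ABC.IUTFork.Cor312Vol.PadicPresentation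

open Thm311

/-- Seat c312-5's field-factor comparison `PadicPresentation.factorMap` (`Cor312SettingDHVol`, the map feeding
`Real.settingDHVol`) IS `factorCoords ∘ comparison` (`Cor312VolumesPadicLatticeBounds`) — hence also the factor-side
comparison of `Cor312ShellLatticeReal` (`sigmaFactor_eq_factorCoords_comp`); all three by `rfl`. [folklore] -/
theorem factorMap_eq_factorCoords_comp {T : ThetaIndex} {L : LogShells T} {vQ : T.VQ} {p : ℕ} [Fact p.Prime]
    (P : PadicPresentation L vQ p) (j : T.Label) :
    P.factorMap j = fun x => P.factorCoords j (P.comparison j x) :=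
  rfl

end Summit.ABC.IUTFork.Cor312Vol.PadicPresentation
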